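import Summits.CriticalPhenomena.PercolationContinuityZ3.Theorems.PercNearOneGluingNoHeavyLowerTailKnQuestion8CoefficientwiseInGadgetCex
import Summits.CriticalPhenomena.PercolationContinuityZ3.Theorems.PercNearOneGluingNoHeavyLowerTailKnQuestion8CoefficientwiseFibrePA
import Mathlib.Data.Fin.VecNotation
import HarnessLib

/-!
# The `K ∪ B`-fibre positivity (M-FIBRE conjecture of prim-lf-2 gen 61) is FALSE — a kernel-checked 6-vertex witness

Support file (`--supports stmt-CriticalPhenomena-4575`, closed), prover `prim-lf-2` (gen 61).  No named facts, no sorries; standard axioms; the arithmetic is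
`decide +kernel` on the two-colour edge recursion `IGCex.cwRec` of `…CoefficientwiseInGadgetCex.lean` (`2⁶` leaves).  Memo `prim-lf-2/CW-FIBRE-gen61.md` §11.

`…CoefficientwiseFibrePA.lean` (p554439) reduced the two-sided avoidance sums `Σ_{K∩X=∅=B∩X} T(K,B)` (in particular the atom `A₀₀` of NC-SPLIT) to the hypothesis that every
fibre `{s : K s ∪ K(E∖s) = M}` of `M = K ∪ B` is twisted positively associated, which forces `0 ≤ Σ_{fibre} T` (`flipBlock_tsum_nonneg`); gen 61 verified this for every fibre of
every connected graph on ≤ 5 vertices.  It FAILS on 6 vertices: `G` = the 4-cycle `0–2–1–3–0` with two pendant edges `1–4`, `1–5`, root `0`, fibre `M = V`, `f = pt 3`, `g = pt 2`: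
the fibre sum is `−2` (`+6` from `(K,B) = ({0},V)×3, (V,{0})×3`, `−8` from the eight crossed pairs with `1 ∈ K ∩ B` and the pendants split between the clusters).
* `Coefficientwise.FibreCex.fibre_sum_eq` — `Σ_{s ⊆ E : K s ∪ K(E∖s) = univ} (pt 3 (K s) − pt 3 (K(E∖s)))(pt 2 (K s) − pt 2 (K(E∖s))) = −2` (`E` = all six edges);
* `Coefficientwise.FibreCex.not_fibre_tsum_nonneg` — so "every fibre has a nonnegative T-sum" is false;
* `Coefficientwise.FibreCex.not_fibrePA` — and the hypothesis `hPA` of `twoSidedAvoidance_tsum_nonneg_of_fibrePA` fails for this graph (via `flipBlock_tsum_nonneg`).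
The two-sided avoidance sums themselves (`(I1)_X`, exhaustive on ≤ 6 vertices) are NOT refuted: negative fibres are compensated inside `D_X`.
[cite: KozmaNitzan2024, Questions 8–9 (§5.5 p. 36) (context: the Question-8 pocket covariance programme)]
-/

namespace Summit.CriticalPhenomena.PercolationContinuityZ3.Theorems

open Finset Literature.Probability.Percolation Literature.Computation.FiniteGraph

namespace Coefficientwise

namespace FibreCex

open IGCex

/-- Edge table of the witness: the 4-cycle `0–2–1–3–0` and the pendant edges `1–4`, `1–5`. -/
def EL₄ : Fin 6 → ℕ × ℕ := ![(0,2), (0,3), (1,2), (1,3), (1,4), (1,5)]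

/-- All entries of `EL₄` are vertices of `Fin 6`. -/
theorem hEL₄ : ∀ i, (EL₄ i).1 < 6 ∧ (EL₄ i).2 < 6 := by decide

/-- The 6-vertex graph of the witness. -/
def ends₄ : Fin 6 → Sym2 (Fin 6) := endsOf EL₄ hEL₄

/-- All six edges as a list (for the recursion). -/
def lE₄ : List (Fin 6) := [0, 1, 2, 3, 4, 5]

/-- The red cluster of the root `0` as a function of the red edge set. -/
noncomputable def K₄ (s : Finset (Fin 6)) : Set (Fin 6) := openCluster (ends₄ '' (↑s : Set (Fin 6))) 0

/-- Integer leaf of the fibre sum: `[1,…,5 all covered]·(r₃ − b₃)(r₂ − b₂)`. -/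
def leaf₄ (lr lb : List ℕ) : ℤ :=
  leafB ((jl lr 0 1 || jl lb 0 1) && ((jl lr 0 2 || jl lb 0 2) && ((jl lr 0 3 || jl lb 0 3) && ((jl lr 0 4 || jl lb 0 4) && (jl lr 0 5 || jl lb 0 5)))))
    (jl lr 0 3) (jl lb 0 3) (jl lr 0 2) (jl lb 0 2)

/-- Kernel evaluation: the fibre recursion of the witness is `−2`. -/
theorem cwRec₄ : cwRec leaf₄ (lE₄.map EL₄) (List.range 6) (List.range 6) = -2 := by
  decide +kernel

open Classical in
/-- Real leaf of the fibre sum as a function of the red and blue edge sets. -/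
noncomputable def LEAF₄ (R B : Finset (Fin 6)) : ℝ :=
  (if ((1 : Fin 6) ∈ openCluster (ends₄ '' (↑R : Set (Fin 6))) 0 ∨ (1 : Fin 6) ∈ openCluster (ends₄ '' (↑B : Set (Fin 6))) 0) ∧
        (((2 : Fin 6) ∈ openCluster (ends₄ '' (↑R : Set (Fin 6))) 0 ∨ (2 : Fin 6) ∈ openCluster (ends₄ '' (↑B : Set (Fin 6))) 0) ∧
          (((3 : Fin 6) ∈ openCluster (ends₄ '' (↑R : Set (Fin 6))) 0 ∨ (3 : Fin 6) ∈ openCluster (ends₄ '' (↑B : Set (Fin 6))) 0) ∧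
            (((4 : Fin 6) ∈ openCluster (ends₄ '' (↑R : Set (Fin 6))) 0 ∨ (4 : Fin 6) ∈ openCluster (ends₄ '' (↑B : Set (Fin 6))) 0) ∧
              ((5 : Fin 6) ∈ openCluster (ends₄ '' (↑R : Set (Fin 6))) 0 ∨ (5 : Fin 6) ∈ openCluster (ends₄ '' (↑B : Set (Fin 6))) 0))))
    then (1 : ℝ) else 0) *
    ((pt 3 (openCluster (ends₄ '' (↑R : Set (Fin 6))) 0) - pt 3 (openCluster (ends₄ '' (↑B : Set (Fin 6))) 0)) *
      (pt 2 (openCluster (ends₄ '' (↑R : Set (Fin 6))) 0) - pt 2 (openCluster (ends₄ '' (↑B : Set (Fin 6))) 0)))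

/-- Boolean form of the covering predicate. [folklore] -/
theorem bool_cover {A₁ B₁ A₂ B₂ A₃ B₃ A₄ B₄ A₅ B₅ : Prop} {a₁ b₁ a₂ b₂ a₃ b₃ a₄ b₄ a₅ b₅ : Bool}
    (ha₁ : A₁ ↔ a₁ = true) (hb₁ : B₁ ↔ b₁ = true) (ha₂ : A₂ ↔ a₂ = true) (hb₂ : B₂ ↔ b₂ = true) (ha₃ : A₃ ↔ a₃ = true) (hb₃ : B₃ ↔ b₃ = true)
    (ha₄ : A₄ ↔ a₄ = true) (hb₄ : B₄ ↔ b₄ = true) (ha₅ : A₅ ↔ a₅ = true) (hb₅ : B₅ ↔ b₅ = true) :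
    ((A₁ ∨ B₁) ∧ ((A₂ ∨ B₂) ∧ ((A₃ ∨ B₃) ∧ ((A₄ ∨ B₄) ∧ (A₅ ∨ B₅))))) ↔
      ((a₁ || b₁) && ((a₂ || b₂) && ((a₃ || b₃) && ((a₄ || b₄) && (a₅ || b₅))))) = true := by
  rw [ha₁, hb₁, ha₂, hb₂, ha₃, hb₃, ha₄, hb₄, ha₅, hb₅]
  simp only [Bool.and_eq_true, Bool.or_eq_true]

open Classical in
/-- The integer leaf computes the real leaf of the witness. -/
theorem HL₄ : ∀ (R B : Finset (Fin 6)) (labR labB : List ℕ),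
    (∃ op : List (ℕ × ℕ), cfgOf 6 op = endsOf EL₄ hEL₄ '' (↑R : Set (Fin 6)) ∧ LabelsOK 6 op labR) →
    (∃ op : List (ℕ × ℕ), cfgOf 6 op = endsOf EL₄ hEL₄ '' (↑B : Set (Fin 6)) ∧ LabelsOK 6 op labB) →
    (leaf₄ labR labB : ℝ) = LEAF₄ R B := by
  intro R B labR labB hR hB
  rw [leaf₄, leafB_cast, LEAF₄, ends₄,
    ite_eq_of_iff (bool_cover (mem_iff_of_inv hR 0 1) (mem_iff_of_inv hB 0 1) (mem_iff_of_inv hR 0 2) (mem_iff_of_inv hB 0 2)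
      (mem_iff_of_inv hR 0 3) (mem_iff_of_inv hB 0 3) (mem_iff_of_inv hR 0 4) (mem_iff_of_inv hB 0 4) (mem_iff_of_inv hR 0 5) (mem_iff_of_inv hB 0 5)),
    pt_eq_of_iff (mem_iff_of_inv hR 0 3), pt_eq_of_iff (mem_iff_of_inv hB 0 3), pt_eq_of_iff (mem_iff_of_inv hR 0 2), pt_eq_of_iff (mem_iff_of_inv hB 0 2)]
  rfl

/-- The fibre predicate `K s ∪ K(E∖s) = univ` of the witness as a finite conjunction (the root `0` always lies in `K s`). [folklore] -/
theorem cover_iff (A B : Set (Fin 6)) (h0 : (0 : Fin 6) ∈ A) :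
    A ∪ B = Set.univ ↔ (((1 : Fin 6) ∈ A ∨ (1 : Fin 6) ∈ B) ∧ (((2 : Fin 6) ∈ A ∨ (2 : Fin 6) ∈ B) ∧ (((3 : Fin 6) ∈ A ∨ (3 : Fin 6) ∈ B) ∧
      (((4 : Fin 6) ∈ A ∨ (4 : Fin 6) ∈ B) ∧ ((5 : Fin 6) ∈ A ∨ (5 : Fin 6) ∈ B))))) := by
  rw [Set.eq_univ_iff_forall]
  constructor
  · intro h; exact ⟨h 1, h 2, h 3, h 4, h 5⟩
  · rintro ⟨h1, h2, h3, h4, h5⟩ v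
    fin_cases v
    · exact Or.inl h0
    · exact h1
    · exact h2
    · exact h3
    · exact h4
    · exact h5

open Classical in
/-- **The fibre sum of the witness is `−2`**: over the colourings `s` with `K s ∪ K(E ∖ s) = univ` (`E` = all six edges, `K₄ s` the red cluster of `0`),
`Σ (pt 3 (K s) − pt 3 (K(E∖s)))·(pt 2 (K s) − pt 2 (K(E∖s))) = −2`. -/
theorem fibre_sum_eq :
    (∑ s ∈ (univ : Finset (Fin 6)).powerset.filter (fun s : Finset (Fin 6) => K₄ s ∪ K₄ (univ \ s) = Set.univ),
      (pt 3 (K₄ s) - pt 3 (K₄ (univ \ s))) * (pt 2 (K₄ s) - pt 2 (K₄ (univ \ s)))) = -2 := by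
  have hbridge := cwRec_eq_sum EL₄ hEL₄ leaf₄ LEAF₄ HL₄ lE₄ (by decide) ∅ ∅ _ _ (inv_empty EL₄ hEL₄) (inv_empty EL₄ hEL₄)
  have hl : lE₄.toFinset = (univ : Finset (Fin 6)) := by decide
  rw [hl, cwRec₄] at hbridge
  rw [Finset.sum_filter]
  have hsum : ∀ s ∈ (univ : Finset (Fin 6)).powerset,
      (if K₄ s ∪ K₄ (univ \ s) = Set.univ then (pt 3 (K₄ s) - pt 3 (K₄ (univ \ s))) * (pt 2 (K₄ s) - pt 2 (K₄ (univ \ s))) else 0) =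
        LEAF₄ (∅ ∪ s) (∅ ∪ (univ \ s)) := by
    intro s _
    have h0 : (0 : Fin 6) ∈ K₄ s := mem_openCluster_self _ 0
    by_cases hc : K₄ s ∪ K₄ (univ \ s) = Set.univ
    · have hc' := (cover_iff _ _ h0).mp hc
      rw [if_pos hc]
      simp only [K₄] at hc' ⊢
      simp only [Finset.empty_union, LEAF₄, if_pos hc', one_mul]
    · have hc' : ¬ (((1 : Fin 6) ∈ K₄ s ∨ (1 : Fin 6) ∈ K₄ (univ \ s)) ∧ (((2 : Fin 6) ∈ K₄ s ∨ (2 : Fin 6) ∈ K₄ (univ \ s)) ∧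
          (((3 : Fin 6) ∈ K₄ s ∨ (3 : Fin 6) ∈ K₄ (univ \ s)) ∧ (((4 : Fin 6) ∈ K₄ s ∨ (4 : Fin 6) ∈ K₄ (univ \ s)) ∧
            ((5 : Fin 6) ∈ K₄ s ∨ (5 : Fin 6) ∈ K₄ (univ \ s)))))) := fun h => hc ((cover_iff _ _ h0).mpr h)
      rw [if_neg hc]
      simp only [K₄] at hc' ⊢
      simp only [Finset.empty_union, LEAF₄, if_neg hc', zero_mul]
  rw [Finset.sum_congr rfl hsum, ← hbridge]
  norm_num

open Classical in
/-- **Fibre T-sums are not always nonnegative**: for the witness graph, root `0` and the monotone point functions `pt 3`, `pt 2`, the fibre `M = univ` has sum `−2 < 0`. -/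
theorem not_fibre_tsum_nonneg :
    ¬ (∀ M : Set (Fin 6), 0 ≤ ∑ s ∈ (univ : Finset (Fin 6)).powerset.filter (fun s : Finset (Fin 6) => K₄ s ∪ K₄ (univ \ s) = M),
      (pt 3 (K₄ s) - pt 3 (K₄ (univ \ s))) * (pt 2 (K₄ s) - pt 2 (K₄ (univ \ s)))) := by
  intro h
  have h0 := h Set.univ
  rw [fibre_sum_eq] at h0
  linarith

open Classical in
/-- **The hypothesis `hPA` of `twoSidedAvoidance_tsum_nonneg_of_fibrePA` fails for the witness**: the fibre `M = univ` of `K₄` is not twisted positively associated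
(otherwise `flipBlock_tsum_nonneg` would make its T-sum nonnegative). -/
theorem not_fibrePA :
    ¬ (∀ M : Set (Fin 6), ∀ Φ Ψ : Finset (Fin 6) → ℝ,
      (∀ s ∈ (univ : Finset (Fin 6)).powerset.filter (fun s => K₄ s ∪ K₄ (univ \ s) = M),
        ∀ t ∈ (univ : Finset (Fin 6)).powerset.filter (fun s => K₄ s ∪ K₄ (univ \ s) = M),
          K₄ s ⊆ K₄ t → K₄ (univ \ t) ⊆ K₄ (univ \ s) → Φ s ≤ Φ t) →
      (∀ s ∈ (univ : Finset (Fin 6)).powerset.filter (fun s => K₄ s ∪ K₄ (univ \ s) = M),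
        ∀ t ∈ (univ : Finset (Fin 6)).powerset.filter (fun s => K₄ s ∪ K₄ (univ \ s) = M),
          K₄ s ⊆ K₄ t → K₄ (univ \ t) ⊆ K₄ (univ \ s) → Ψ s ≤ Ψ t) →
      (∑ s ∈ (univ : Finset (Fin 6)).powerset.filter (fun s => K₄ s ∪ K₄ (univ \ s) = M), Φ s) *
        (∑ s ∈ (univ : Finset (Fin 6)).powerset.filter (fun s => K₄ s ∪ K₄ (univ \ s) = M), Ψ s) ≤
        (((univ : Finset (Fin 6)).powerset.filter (fun s => K₄ s ∪ K₄ (univ \ s) = M)).card : ℝ) *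
          ∑ s ∈ (univ : Finset (Fin 6)).powerset.filter (fun s => K₄ s ∪ K₄ (univ \ s) = M), Φ s * Ψ s) := by
  intro hPA
  have key := twoSidedAvoidance_tsum_nonneg_of_fibrePA (univ : Finset (Fin 6)) K₄ (∅ : Set (Fin 6)) (pt 3) (pt 2) (pt_monotone 3) (pt_monotone 2) hPA
  -- with `X = ∅` the avoidance event is everything; split it into the fibre `M = univ` and the rest is not needed: use the block lemma on the fibre directly
  set F : Finset (Finset (Fin 6)) := (univ : Finset (Fin 6)).powerset.filter (fun s => K₄ s ∪ K₄ (univ \ s) = Set.univ) with hF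
  have hFE : ∀ s ∈ F, s ⊆ univ := fun s _ => subset_univ s
  have hflip : ∀ s ∈ F, univ \ s ∈ F := by
    intro s hs
    obtain ⟨_, hM⟩ := Finset.mem_filter.mp hs
    refine Finset.mem_filter.mpr ⟨Finset.mem_powerset.mpr Finset.sdiff_subset, ?_⟩
    rw [Finset.sdiff_sdiff_eq_self (subset_univ s), Set.union_comm]; exact hM
  have hnn := flipBlock_tsum_nonneg (univ : Finset (Fin 6)) K₄ F (pt 3) (pt 2) (pt_monotone 3) (pt_monotone 2) hFE hflip (hPA Set.univ)
  rw [hF, fibre_sum_eq] at hnn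
  linarith

end FibreCex

end Coefficientwise

end Summit.CriticalPhenomena.PercolationContinuityZ3.Theorems
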